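import Summits.HubbardSuperconductivity.HubbardSuperconductivity.Theorems.CooperSharpnessTwistAveragingBoundDefs
import Literature.MathematicalPhysics.QuantumLattice.HubbardLSMFillingProofs
import Literature.MathematicalPhysics.QuantumLattice.ApproximateEigenvectorLemmas

/-!
# Route `CooperSharpness`, support `TwistAveragingBound` (item `stmt-HubbardSuperconductivity-12854`),
# part 2: periodicity, sector invariance and kinetic cost of the charge twists

For `k ∈ (ℤ/Lℤ)²` let `T_k = fockTwist (chargeTwist L k)` (vocabulary of
`CooperSharpnessTwistAveragingBoundDefs`). This file proves the generic facts about `fockTwist` used by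
the twist average (angles agreeing mod `2π` give the same unitary; isometry; conjugated Rayleigh
quotients; invariance of every joint sector `(N, S^z = M)`), the periodicity `T_{-k} = T_k⁻¹`, and the
Lieb–Schultz–Mattis kinetic cost of the `±k` pair of twisted trial vectors of the pure torus
Hamiltonian `hubbardTorus 2 L 1 U`:
`re⟨T_k⁻¹ψ, H T_k⁻¹ψ⟩ + re⟨T_kψ, H T_kψ⟩ ≤ 2 re⟨ψ, Hψ⟩ + 16π²(a₀² + a₁²)` for `k = (a₀, a₁) mod L`
and unit `ψ` (`fockTwist_conj_hamiltonianWith_add`, `re_expect_lsmPerturbation_le`: `4L²` ordered bonds,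
each `↑`-bond phase `2π aᵢ/L` mod `2π`, `1 - cos x ≤ x²/2`), together with the pair weight of a twisted
vector as a vector norm, `re⟨T_k⁻¹ψ, Δᴴ Δ T_k⁻¹ψ⟩ = ‖T_k Δ T_k⁻¹ ψ‖₂²`.
Sources: E. Lieb, T. Schultz, D. Mattis, Ann. Phys. 16 (1961) 407, App. B; T. Koma, H. Tasaki,
PRL 68 (1992) 3248, eq. (5)–(8). Finite-dimensional linear algebra throughout; no new definitions
of record (`kOfInt` is a proof-local abbreviation for the momentum of an integer pair).
-/

-- the mandated namespace `Summit.<Summit>.<Problem>.Theorems` repeats `HubbardSuperconductivity`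
-- (single-problem summit, D-0017), which the `dupNamespace` linter flags on every declaration
set_option linter.dupNamespace false

noncomputable section

namespace Summit.HubbardSuperconductivity.HubbardSuperconductivity.Theorems.CooperSharpness

open Matrix Complex Finset Literature.MathematicalPhysics.QuantumLattice
  Literature.Probability.LatticeModels
open scoped ComplexConjugate ComplexOrder Matrix.Norms.L2Operator

/-! ### Generic facts about the phase twist `fockTwist` -/

section FockTwist

variable {ι : Type*} [LinearOrder ι]

/-- Two twist-angle assignments that agree modulo `2π` orbital by orbital give the same twist
operator. [folklore] -/
theorem fockTwist_eq_of_sub_eq (θ θ' : ι → ℝ) (h : ∀ j, ∃ n : ℤ, θ j - θ' j = 2 * Real.pi * n) :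
    fockTwist θ = fockTwist θ' := by
  choose n hn using h
  rw [fockTwist, fockTwist]
  congr 1
  funext s
  have hs : ∑ i ∈ s, θ i = ∑ i ∈ s, θ' i + 2 * Real.pi * ∑ i ∈ s, (n i : ℝ) := by
    rw [Finset.mul_sum, ← Finset.sum_add_distrib]
    exact Finset.sum_congr rfl fun i _ => by linarith [hn i]
  rw [hs]
  push_cast
  rw [add_mul, Complex.exp_add]
  have : cexp (2 * (Real.pi : ℂ) * (∑ i ∈ s, (n i : ℂ)) * I) = 1 := by
    have h1 : (2 * (Real.pi : ℂ) * (∑ i ∈ s, (n i : ℂ)) * I) =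
        ((∑ i ∈ s, n i : ℤ) : ℂ) * (2 * Real.pi * I) := by push_cast; ring
    rw [h1, Complex.exp_int_mul_two_pi_mul_I]
  rw [this, mul_one]

variable [Fintype ι]

/-- The twist is an isometry: `⟨U(θ)ψ, U(θ)ψ⟩ = ⟨ψ, ψ⟩`. [folklore] -/
theorem star_fockTwist_mulVec_dotProduct (θ : ι → ℝ) (ψ : Fock ι) :
    star (fockTwist θ *ᵥ ψ) ⬝ᵥ (fockTwist θ *ᵥ ψ) = star ψ ⬝ᵥ ψ := by
  rw [star_mulVec, ← dotProduct_mulVec, conjTranspose_fockTwist_mulVec_mulVec]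

/-- Rayleigh quotients of twisted vectors: `⟨U(θ)ψ, A U(θ)ψ⟩ = ⟨ψ, (U(-θ) A U(θ)) ψ⟩`.
[folklore] -/
theorem star_fockTwist_mulVec_dotProduct_mulVec (θ : ι → ℝ) (A : Matrix (Finset ι) (Finset ι) ℂ)
    (ψ : Fock ι) :
    star (fockTwist θ *ᵥ ψ) ⬝ᵥ A *ᵥ (fockTwist θ *ᵥ ψ) =
      star ψ ⬝ᵥ (fockTwist (-θ) * A * fockTwist θ) *ᵥ ψ := by
  rw [Matrix.star_mulVec_dotProduct_mulVec, conjTranspose_fockTwist]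

/-- The Euclidean norm is twist invariant. [folklore] -/
theorem eucNorm_fockTwist_mulVec (θ : ι → ℝ) (v : Fock ι) :
    eucNorm (fockTwist θ *ᵥ v) = eucNorm v :=
  eucNorm_mulVec_of_conjTranspose_mul_self (conjTranspose_fockTwist_mul_self θ) v

end FockTwist

section Sector

variable {Λ : Type*} [LinearOrder Λ] [Fintype Λ]

/-- **Phase twists preserve every joint sector `(N, S^z = M)`** (they are diagonal in the
occupation basis, as are `N` and `S^z`). Koma–Tasaki, PRL 68 (1992) 3248, after eq. (5).
[folklore] -/
theorem fockTwist_mulVec_mem_szSector (θ : Orb Λ → ℝ) {N : ℕ} {M : ℝ} {ψ : Fock (Orb Λ)}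
    (h : ψ ∈ szSector N M) : fockTwist θ *ᵥ ψ ∈ szSector N M := by
  rw [mem_szSector_iff] at h ⊢
  obtain ⟨hN, hZ⟩ := h
  refine ⟨fun s hs => by rw [fockTwist_mulVec_apply, hN s hs, mul_zero], ?_⟩
  funext s
  have hs := congrFun hZ s
  rw [spinZ_mulVec_apply, Pi.smul_apply, smul_eq_mul] at hs ⊢
  rw [fockTwist_mulVec_apply]
  linear_combination cexp (((∑ i ∈ s, θ i : ℝ) : ℂ) * I) * hs

end Sector

/-! ### The charge twist at momentum `k`: periodicity, cost and pair weight -/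

section ChargeTwist

variable {L : ℕ} [NeZero L]

/-- `T_{-k} = T_k⁻¹`: the twist angles of `-k` and the negated angles of `k` agree modulo `2π`
(`(-a).val + a.val ∈ {0, L}` in `ℤ/Lℤ`). [folklore] -/
theorem fockTwist_chargeTwist_neg (k : TorusSite 2 L) :
    fockTwist (chargeTwist L (-k)) = fockTwist (-chargeTwist L k) := by
  refine fockTwist_eq_of_sub_eq _ _ fun j => ?_
  by_cases hσ : (ofLex j).2 = 0
  · simp only [chargeTwist, Pi.neg_apply, hσ, ↓reduceIte, sub_neg_eq_add]
    have hneg : (∑ i, -k i * FermionTorus.toTorusSite (ofLex j).1 i) =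
        -(∑ i, k i * FermionTorus.toTorusSite (ofLex j).1 i) := by
      simp [Finset.sum_neg_distrib]
    rw [hneg]
    set a : ZMod L := ∑ i, k i * FermionTorus.toTorusSite (ofLex j).1 i with ha
    have hL : (0 : ℝ) < L := Nat.cast_pos.2 (Nat.pos_of_ne_zero (NeZero.ne L))
    by_cases h0 : a = 0
    · refine ⟨0, ?_⟩
      rw [h0, neg_zero, ZMod.val_zero]
      simp
    · refine ⟨1, ?_⟩
      rw [ZMod.neg_val, if_neg h0, Nat.cast_sub (ZMod.val_lt a).le]
      push_cast
      field_simp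
      ring
  · refine ⟨0, ?_⟩
    simp [chargeTwist, hσ]

omit [NeZero L] in
/-- The pure torus Hamiltonian as a `hamiltonianWith` at `μ = 0`. [folklore] -/
theorem hubbardTorus_eq_hamiltonianWith (U : ℝ) :
    hubbardTorus 2 L 1 U = hamiltonianWith (fermionTorusGraph 2 L) 1 U 0 := by
  rw [hamiltonianWith_zero]; rfl

/-- **Sum of the two oppositely twisted energies** of a vector:
`⟨T_k⁻¹ψ, H T_k⁻¹ψ⟩ + ⟨T_kψ, H T_kψ⟩ = 2 re⟨ψ, Hψ⟩ + 2 re⟨ψ, P_θ ψ⟩` for the pure torus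
Hamiltonian `H = hubbardTorus 2 L 1 U` and `θ = chargeTwist L k`.
Lieb–Schultz–Mattis (1961), App. B, eq. (B-5). [folklore] -/
theorem re_twisted_energy_add (U : ℝ) (k : TorusSite 2 L) (ψ : Fock (Orb (FermionTorus 2 L))) :
    (star (fockTwist (-chargeTwist L k) *ᵥ ψ) ⬝ᵥ hubbardTorus 2 L 1 U *ᵥ
        (fockTwist (-chargeTwist L k) *ᵥ ψ)).re +
      (star (fockTwist (chargeTwist L k) *ᵥ ψ) ⬝ᵥ hubbardTorus 2 L 1 U *ᵥ
        (fockTwist (chargeTwist L k) *ᵥ ψ)).re =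
      2 * (star ψ ⬝ᵥ hubbardTorus 2 L 1 U *ᵥ ψ).re +
        2 * (star ψ ⬝ᵥ lsmPerturbation (fermionTorusGraph 2 L) (chargeTwist L k) 1 *ᵥ ψ).re := by
  rw [star_fockTwist_mulVec_dotProduct_mulVec, star_fockTwist_mulVec_dotProduct_mulVec, neg_neg,
    ← Complex.add_re, ← dotProduct_add, ← add_mulVec, hubbardTorus_eq_hamiltonianWith,
    fockTwist_conj_hamiltonianWith_add, add_mulVec, dotProduct_add, Complex.add_re, smul_mulVec,
    smul_mulVec, dotProduct_smul, dotProduct_smul]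
  simp only [smul_eq_mul, Complex.mul_re, Complex.re_ofNat, Complex.im_ofNat, zero_mul, sub_zero]

/-- The momentum attached to a pair of integers `(a₀, a₁)`: `k = (a₀ mod L, a₁ mod L)`. -/
abbrev kOfInt (L : ℕ) (p : ℤ × ℤ) : TorusSite 2 L := ![(p.1 : ZMod L), (p.2 : ZMod L)]

omit [NeZero L] in
/-- `kOfInt` is odd. [folklore] -/
theorem kOfInt_neg (p : ℤ × ℤ) : kOfInt L (-p) = -kOfInt L p := by
  ext i
  fin_cases i <;> simp [kOfInt]

/-- **Bond phase of the charge twist.** For adjacent torus sites `u ∼ v` and `k = (a₀, a₁) mod L`,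
the `↑`-twist angles differ by `2π aᵢ/L` modulo `2π` for the bond direction `i`, whence
`|cos(θ_{u↑} - θ_{v↑}) - 1| ≤ 2π² (a₀² + a₁²)/L²` (`1 - cos x ≤ x²/2`). [folklore] -/
theorem abs_cos_chargeTwist_sub_one_le (p : ℤ × ℤ) {u v : FermionTorus 2 L}
    (huv : (fermionTorusGraph 2 L).Adj u v) :
    |Real.cos (chargeTwist L (kOfInt L p) (orb u 0) - chargeTwist L (kOfInt L p) (orb v 0)) - 1| ≤
      2 * Real.pi ^ 2 * ((p.1 : ℝ) ^ 2 + (p.2 : ℝ) ^ 2) / (L : ℝ) ^ 2 := by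
  have hL : (0 : ℝ) < L := Nat.cast_pos.2 (Nat.pos_of_ne_zero (NeZero.ne L))
  set k := kOfInt L p with hk
  set nu : ℕ := (∑ i, k i * FermionTorus.toTorusSite u i).val with hnu
  set nv : ℕ := (∑ i, k i * FermionTorus.toTorusSite v i).val with hnv
  rw [chargeTwist_up, chargeTwist_up, ← hnu, ← hnv]
  -- the bond direction
  rw [fermionTorusGraph_adj, torusGraph_adj_iff] at huv
  obtain ⟨-, hdir⟩ := huv
  -- an integer `a` with `a² ≤ |p|²` and `nv ≡ nu + a (mod L)`
  have hku : ((nu : ℕ) : ZMod L) = ∑ i, k i * FermionTorus.toTorusSite u i := by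
    rw [hnu, ZMod.natCast_zmod_val]
  have hkv : ((nv : ℕ) : ZMod L) = ∑ i, k i * FermionTorus.toTorusSite v i := by
    rw [hnv, ZMod.natCast_zmod_val]
  obtain ⟨a, ha2, hmod⟩ : ∃ a : ℤ, (a : ℝ) ^ 2 ≤ (p.1 : ℝ) ^ 2 + (p.2 : ℝ) ^ 2 ∧
      ((nv : ℕ) : ZMod L) = ((nu : ℕ) : ZMod L) + (a : ZMod L) := by
    rcases hdir with ⟨i, hi⟩ | ⟨i, hi⟩ <;> fin_cases i
    · refine ⟨p.1, by nlinarith [sq_nonneg (p.2 : ℝ)], ?_⟩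
      rw [hku, hkv, hi]
      simp [hk, kOfInt, Fin.sum_univ_two, Pi.single_apply]
      ring
    · refine ⟨p.2, by nlinarith [sq_nonneg (p.1 : ℝ)], ?_⟩
      rw [hku, hkv, hi]
      simp [hk, kOfInt, Fin.sum_univ_two, Pi.single_apply]
      ring
    · refine ⟨-p.1, by push_cast; nlinarith [sq_nonneg (p.2 : ℝ)], ?_⟩
      rw [hku, hkv, hi]
      simp [hk, kOfInt, Fin.sum_univ_two, Pi.single_apply]
      ring
    · refine ⟨-p.2, by push_cast; nlinarith [sq_nonneg (p.1 : ℝ)], ?_⟩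
      rw [hku, hkv, hi]
      simp [hk, kOfInt, Fin.sum_univ_two, Pi.single_apply]
      ring
  -- hence `nu - nv = -a + L q`
  have hdvd : (L : ℤ) ∣ ((nu : ℤ) + a - nv) := by
    rw [← ZMod.intCast_zmod_eq_zero_iff_dvd]
    push_cast
    rw [hmod]
    ring
  obtain ⟨q, hq⟩ := hdvd
  have hdiff : (nu : ℝ) - nv = -a + L * q := by
    have h'' := congrArg (fun z : ℤ => (z : ℝ)) hq
    push_cast at h''
    linarith
  have hcos : Real.cos (2 * Real.pi / L * nu - 2 * Real.pi / L * nv) =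
      Real.cos (2 * Real.pi * a / L) := by
    rw [← mul_sub, hdiff]
    have : 2 * Real.pi / L * (-(a : ℝ) + L * q) = -(2 * Real.pi * a / L) + q * (2 * Real.pi) := by
      field_simp
    rw [this, Real.cos_add_int_mul_two_pi, Real.cos_neg]
  rw [hcos]
  have h1 : Real.cos (2 * Real.pi * a / L) ≤ 1 := Real.cos_le_one _
  have h2 := Real.one_sub_sq_div_two_le_cos (x := 2 * Real.pi * a / L)
  rw [abs_of_nonpos (by linarith)]
  have h3 : (2 * Real.pi * a / L) ^ 2 / 2 = 2 * Real.pi ^ 2 * (a : ℝ) ^ 2 / (L : ℝ) ^ 2 := by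
    field_simp
  rw [h3] at h2
  have h4 : 2 * Real.pi ^ 2 * (a : ℝ) ^ 2 / (L : ℝ) ^ 2 ≤
      2 * Real.pi ^ 2 * ((p.1 : ℝ) ^ 2 + (p.2 : ℝ) ^ 2) / (L : ℝ) ^ 2 := by
    gcongr
  linarith

/-- **Kinetic cost of the charge twist** (form bound of the Lieb–Schultz–Mattis perturbation):
`re⟨ψ, P_θ ψ⟩ ≤ 8π² (a₀² + a₁²) ⟨ψ, ψ⟩` for `θ = chargeTwist L (a₀, a₁)` and `t = 1`
(`4L²` ordered bonds, each contributing `≤ 2π²|a|²/L²` from the `↑` spin and `0` from `↓`).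
Lieb–Schultz–Mattis (1961), App. B. [folklore] -/
theorem re_expect_lsmPerturbation_chargeTwist_le (p : ℤ × ℤ) (ψ : Fock (Orb (FermionTorus 2 L))) :
    (star ψ ⬝ᵥ lsmPerturbation (fermionTorusGraph 2 L) (chargeTwist L (kOfInt L p)) 1 *ᵥ ψ).re ≤
      8 * Real.pi ^ 2 * ((p.1 : ℝ) ^ 2 + (p.2 : ℝ) ^ 2) * (star ψ ⬝ᵥ ψ).re := by
  have hL : (0 : ℝ) < L := Nat.cast_pos.2 (Nat.pos_of_ne_zero (NeZero.ne L))
  have hnn : 0 ≤ (star ψ ⬝ᵥ ψ).re := by rw [star_dotProduct_self_re]; positivity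
  refine (re_expect_lsmPerturbation_le (fermionTorusGraph 2 L) _ 1 ψ).trans ?_
  rw [abs_one, one_mul]
  refine mul_le_mul_of_nonneg_right ?_ hnn
  set c : ℝ := 2 * Real.pi ^ 2 * ((p.1 : ℝ) ^ 2 + (p.2 : ℝ) ^ 2) / (L : ℝ) ^ 2 with hc
  have hc0 : 0 ≤ c := by positivity
  have hbond : ∀ u v : FermionTorus 2 L,
      (if (fermionTorusGraph 2 L).Adj u v then ∑ σ : Fin 2,
        |Real.cos (chargeTwist L (kOfInt L p) (orb u σ) - chargeTwist L (kOfInt L p) (orb v σ)) - 1|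
        else 0) ≤ (if (fermionTorusGraph 2 L).Adj u v then c else 0) := by
    intro u v
    split_ifs with huv
    · rw [Fin.sum_univ_two, chargeTwist_down, chargeTwist_down, sub_self, Real.cos_zero, sub_self,
        abs_zero, add_zero]
      exact abs_cos_chargeTwist_sub_one_le p huv
    · exact le_rfl
  calc (∑ u : FermionTorus 2 L, ∑ v : FermionTorus 2 L,
        if (fermionTorusGraph 2 L).Adj u v then ∑ σ : Fin 2,
          |Real.cos (chargeTwist L (kOfInt L p) (orb u σ) - chargeTwist L (kOfInt L p) (orb v σ)) - 1|
          else 0)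
      ≤ ∑ u : FermionTorus 2 L, ∑ v : FermionTorus 2 L,
          (if (fermionTorusGraph 2 L).Adj u v then c else 0) :=
        Finset.sum_le_sum fun u _ => Finset.sum_le_sum fun v _ => hbond u v
    _ ≤ (L : ℝ) ^ 2 * (2 * (2 : ℕ)) * c := sum_sum_adj_const_le hc0
    _ = 8 * Real.pi ^ 2 * ((p.1 : ℝ) ^ 2 + (p.2 : ℝ) ^ 2) := by
        rw [hc]; field_simp; push_cast; ring

/-- **Energy of the twisted trial states, averaged over `±k`.** For a unit vector `ψ` and
`k = (a₀, a₁) mod L`: `re⟨φ_k, H φ_k⟩ + re⟨φ_{-k}, H φ_{-k}⟩ ≤ 2 re⟨ψ, Hψ⟩ + 16π²(a₀² + a₁²)`,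
`φ_k = T_k⁻¹ ψ`. Lieb–Schultz–Mattis (1961), App. B. [folklore] -/
theorem re_energy_twist_pair_le (U : ℝ) (p : ℤ × ℤ) {ψ : Fock (Orb (FermionTorus 2 L))}
    (hψ : star ψ ⬝ᵥ ψ = 1) :
    (star (fockTwist (-chargeTwist L (kOfInt L p)) *ᵥ ψ) ⬝ᵥ hubbardTorus 2 L 1 U *ᵥ
        (fockTwist (-chargeTwist L (kOfInt L p)) *ᵥ ψ)).re +
      (star (fockTwist (-chargeTwist L (kOfInt L (-p))) *ᵥ ψ) ⬝ᵥ hubbardTorus 2 L 1 U *ᵥ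
        (fockTwist (-chargeTwist L (kOfInt L (-p))) *ᵥ ψ)).re ≤
      2 * (star ψ ⬝ᵥ hubbardTorus 2 L 1 U *ᵥ ψ).re +
        16 * Real.pi ^ 2 * ((p.1 : ℝ) ^ 2 + (p.2 : ℝ) ^ 2) := by
  have hT := fockTwist_chargeTwist_neg (-kOfInt L p)
  rw [neg_neg] at hT
  rw [kOfInt_neg, ← hT, re_twisted_energy_add]
  have h := re_expect_lsmPerturbation_chargeTwist_le p ψ
  rw [hψ, Complex.one_re, mul_one] at h
  linarith

/-- **Pair weight of a twisted trial state**: `re⟨φ_k, pFᴴ pF φ_k⟩ = ‖T_k pF T_k⁻¹ ψ‖₂²`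
for `φ_k = T_k⁻¹ψ` (the twist is an isometry). [folklore] -/
theorem re_expect_pairPenalty_twist_eq (k : TorusSite 2 L) (ψ : Fock (Orb (FermionTorus 2 L))) :
    (star (fockTwist (-chargeTwist L k) *ᵥ ψ) ⬝ᵥ
        ((pairField dWaveFormFactor L)ᴴ * pairField dWaveFormFactor L) *ᵥ
          (fockTwist (-chargeTwist L k) *ᵥ ψ)).re =
      eucNorm ((fockTwist (chargeTwist L k) * pairField dWaveFormFactor L *
        fockTwist (-chargeTwist L k)) *ᵥ ψ) ^ 2 := by
  rw [← mulVec_mulVec, dotProduct_mulVec, ← star_mulVec, ← eucNorm_sq,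
    ← eucNorm_fockTwist_mulVec (chargeTwist L k) (pairField dWaveFormFactor L *ᵥ _),
    mulVec_mulVec, mulVec_mulVec]

/-- `|d-wave form factor| ≤ 1`. [folklore] -/
theorem abs_dWaveFormFactor_le_one (e : Site 2) : |dWaveFormFactor e| ≤ 1 := by
  unfold dWaveFormFactor
  split_ifs <;> simp

end ChargeTwist

end Summit.HubbardSuperconductivity.HubbardSuperconductivity.Theorems.CooperSharpness
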